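import Literature.AlgebraicGeometry.ComplexMultiplication.CyclotomicFermatCMTypesBadCharacterCriterion
import HarnessLib

/-!
# Koblitz–Rohrlich 1978, §2 "Case 4": the Proposition — hence Theorems 1 (i)–(ii) and 2 in the relatively prime case — at every level
# prime to `6` with six to nine prime factors

N. Koblitz, D. Rohrlich, *Simple factors in the Jacobian of a Fermat curve*, Canad. J. Math. **30** (1978) 1183–1205, §2 (pp. 1190–1192).

THE SOURCE.  The Proposition (p. 1190: "Suppose `2, 3 ∤ N`. Let `S(N)` be the set of odd characters of `(ℤ/Nℤ)^*`, and let `S₀(N) ⊂ S(N)` be the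
set of "bad" characters, i.e., `S₀(N) = {χ ∈ S(N) | B_{1,χ} = 0}`.  Then `#S₀(N) < (1/6)#S(N)`") is proved by bounding
`s(N) ≤ Σᵢ 1/((pᵢ − 1)·ordᵢ)` (`ordᵢ` = the order of `pᵢ` in `(ℤ/Nᵢℤ)^*`, `Nᵢ = N/pᵢ^{aᵢ}`) case by case in `m = ω(N)`; for the range of
this file: "Case 4. `5 ≤ m ≤ 9`.  From Table 1, if `pᵢ = 5, 7, 11`, then `ordᵢ ≥ 10, 10, 6`, respectively, and if `13 ≤ pᵢ ≤ 29`, then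
`ordᵢ ≥ 5`. Thus, … Hence, `Σ … < 1/6`" (pp. 1191–1192), using "TABLE 1.  All primes `≥ 5` dividing `pᵐ − 1` for certain `p` and `m`" (p. 1190)
and "Note that `ordᵢ > log_{pᵢ} Nᵢ ≥ m − i`" (p. 1191).

THIS FILE (the case `m = 5` is in the sibling `CyclotomicFermatCMTypesBadCharacterCriterion`, §3) proves the Proposition for `6 ≤ ω(N) ≤ 9`
through the sibling's uniform criterion `twelve_mul_card_bad_lt_totient_of_forall_le`: it suffices that `(ℓ − 1)·d ≥ 6ω(N) + 1` whenever
`ℓ ∣ N` and `N_ℓ ∣ ℓᵈ − 1`.  DEVIATION FROM THE PRINTED PROOF (said once, here): K–R bound the whole sum non-uniformly; we verify the uniform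
per-prime bound instead, which for `ℓ = 5` and `ω(N) = 9` requires `d ≥ 14` and therefore four rows `5ᵈ − 1`, `d = 10, …, 13`, beyond the
printed Table 1 (which stops at `d = 9`); these rows (`5¹⁰ − 1 = 2³·3·11·71·521`, `5¹¹ − 1 = 2²·12207031`, `5¹² − 1 = 2⁴·3²·7·13·31·601`,
`5¹³ − 1 = 2²·305175781`, with `521, 601, 12207031, 305175781` prime) are certified by `norm_num` below, exactly like the printed ones.

* §1 `card_le_four_of_forall_dvd_pow_sub_one` — Table 1, columns `p = 5` (`d ≤ 13`) and `p = 7` (`d ≤ 9`): at most four primes `≥ 5` divide `ℓᵈ − 1`.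
* §2 `criterion_le_sub_one_mul_of_card_mem_Icc` — if `5 ≤ #Q ≤ 8` primes `≥ 5` divide `ℓᵈ − 1` (`ℓ` prime `≥ 5`, `d ≥ 1`), then
  `6(#Q + 1) + 1 ≤ (ℓ − 1)·d` (`ℓ = 5, 7` by §1; `ℓ ≥ 11` by `5^{#Q} ≤ ∏ Q ≤ ℓᵈ − 1`).
* §3 `twelve_mul_card_bad_lt_totient_six_to_nine_primes`, `exists_goodFinset_six_to_nine_primes` — the Proposition for `6 ≤ ω(N) ≤ 9`.
* §4 the `…_sixToNinePrimes` family — Theorems 1 (i), (∗), Theorem 2 (stabiliser / CM type / variety) and Theorem 1 (ii) UNCONDITIONALLY at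
  such levels, by feeding §3 to the `…_of_card` theorems of `CyclotomicFermatCMTypesOddLevelSimple`.

With the siblings (prime powers; two, three, four and five prime factors) the Proposition is now a theorem of the tree at every level prime
to `6` with `ω(N) ≤ 9`; K–R's "Case 5. `m ≥ 10`" (p. 1192, a prime-counting argument) remains.  No new definitions, no named facts.
-/

open NumberField

namespace Literature.AlgebraicGeometry.ComplexMultiplication

open Literature.NumberTheory.ComplexMultiplication
open Literature.NumberTheory.LFunctions

namespace CyclotomicFermatCMType

/-! ## §1 Table 1, extended: `5ᵈ − 1` (`d ≤ 13`) and `7ᵈ − 1` (`d ≤ 9`) have at most four prime factors `≥ 5` -/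

section TableOne

/-- A prime `≥ 5` does not divide `2ⁱ·3ʲ` (private copy). [folklore] -/
private theorem not_dvd_two_pow_mul_three_pow₄ {q : ℕ} (hq : q.Prime) (h5 : 5 ≤ q) (i j : ℕ) : ¬q ∣ 2 ^ i * 3 ^ j := by
  intro h
  rcases (Nat.Prime.dvd_mul hq).1 h with h2 | h3
  · have := (Nat.prime_dvd_prime_iff_eq hq Nat.prime_two).1 (hq.dvd_of_dvd_pow h2)
    omega
  · have := (Nat.prime_dvd_prime_iff_eq hq Nat.prime_three).1 (hq.dvd_of_dvd_pow h3)
    omega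

/-- A prime `q ≥ 5` dividing `2ⁱ·3ʲ·sᵃ·tᵇ·uᶜ·vᵉ` (`s, t, u, v` prime) is one of `s, t, u, v`. [folklore] -/
private theorem mem_of_dvd {q s t u v i j a b c e : ℕ} (hq : q.Prime) (h5 : 5 ≤ q) (hs : s.Prime) (ht : t.Prime)
    (hu : u.Prime) (hv : v.Prime) (h : q ∣ 2 ^ i * 3 ^ j * s ^ a * t ^ b * u ^ c * v ^ e) :
    q ∈ ({s, t, u, v} : Finset ℕ) := by
  simp only [Finset.mem_insert, Finset.mem_singleton]
  rcases (Nat.Prime.dvd_mul hq).1 h with h₁ | h₁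
  · rcases (Nat.Prime.dvd_mul hq).1 h₁ with h₂ | h₂
    · rcases (Nat.Prime.dvd_mul hq).1 h₂ with h₃ | h₃
      · rcases (Nat.Prime.dvd_mul hq).1 h₃ with h₄ | h₄
        · exact absurd h₄ (not_dvd_two_pow_mul_three_pow₄ hq h5 i j)
        · exact Or.inl ((Nat.prime_dvd_prime_iff_eq hq hs).1 (hq.dvd_of_dvd_pow h₄))
      · exact Or.inr (Or.inl ((Nat.prime_dvd_prime_iff_eq hq ht).1 (hq.dvd_of_dvd_pow h₃)))
    · exact Or.inr (Or.inr (Or.inl ((Nat.prime_dvd_prime_iff_eq hq hu).1 (hq.dvd_of_dvd_pow h₂))))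
  · exact Or.inr (Or.inr (Or.inr ((Nat.prime_dvd_prime_iff_eq hq hv).1 (hq.dvd_of_dvd_pow h₁))))

/-- If every element of a finset `Q` of primes `≥ 5` divides `X = 2ⁱ·3ʲ·sᵃ·tᵇ·uᶜ·vᵉ` (`s, t, u, v` prime), then `#Q ≤ 4`. [folklore] -/
private theorem card_le_four_of_forall_dvd {Q : Finset ℕ} {X s t u v i j a b c e : ℕ}
    (hX : X = 2 ^ i * 3 ^ j * s ^ a * t ^ b * u ^ c * v ^ e) (hs : s.Prime) (ht : t.Prime) (hu : u.Prime) (hv : v.Prime)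
    (hQ : ∀ q ∈ Q, q.Prime ∧ 5 ≤ q ∧ q ∣ X) : Q.card ≤ 4 := by
  subst hX
  calc Q.card ≤ ({s, t, u, v} : Finset ℕ).card :=
        Finset.card_le_card fun q hq => mem_of_dvd (hQ q hq).1 (hQ q hq).2.1 hs ht hu hv (hQ q hq).2.2
    _ ≤ 4 := Finset.card_le_four

/-- **TABLE 1 ("All primes `≥ 5` dividing `pᵐ − 1` for certain `p` and `m`"), the columns `p = 5, 7`, extended**: for `ℓ = 5`, `d ≤ 13` and for
`ℓ = 7`, `d ≤ 9`, at most four distinct primes `≥ 5` divide `ℓᵈ − 1`.  The printed rows `d ≤ 9` read (`p = 5`) `—, —, 31, 13, {11,71}, {7,31},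
19531, {13,313}, {19,31,829}` and (`p = 7`) `—, —, 19, 5, 2801, {19,43}, {29,4733}, {5,1201}, {19,37,1063}`; the four further rows for `p = 5`
(NOT printed by K–R, machine-checked here) are `5¹⁰ − 1 = 2³·3·11·71·521`, `5¹¹ − 1 = 2²·12207031`, `5¹² − 1 = 2⁴·3²·7·13·31·601`,
`5¹³ − 1 = 2²·305175781` (`521, 601, 12207031, 305175781` prime). [cite: KoblitzRohrlich1978, §2 Table 1 (p. 1190)] -/
theorem card_le_four_of_forall_dvd_pow_sub_one {ℓ d : ℕ} (hℓ : (ℓ = 5 ∧ d ≤ 13) ∨ (ℓ = 7 ∧ d ≤ 9)) (hd : 0 < d) {Q : Finset ℕ}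
    (hQ : ∀ q ∈ Q, q.Prime ∧ 5 ≤ q ∧ q ∣ ℓ ^ d - 1) : Q.card ≤ 4 := by
  have key : ∀ {i j s a t b u c v e : ℕ}, s.Prime → t.Prime → u.Prime → v.Prime →
      ℓ ^ d - 1 = 2 ^ i * 3 ^ j * s ^ a * t ^ b * u ^ c * v ^ e → Q.card ≤ 4 :=
    fun hs ht hu hv he => card_le_four_of_forall_dvd he hs ht hu hv hQ
  rcases hℓ with ⟨rfl, hd13⟩ | ⟨rfl, hd9⟩
  · have hd' : d = 1 ∨ d = 2 ∨ d = 3 ∨ d = 4 ∨ d = 5 ∨ d = 6 ∨ d = 7 ∨ d = 8 ∨ d = 9 ∨ d = 10 ∨ d = 11 ∨ d = 12 ∨ d = 13 := by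
      omega
    rcases hd' with rfl | rfl | rfl | rfl | rfl | rfl | rfl | rfl | rfl | rfl | rfl | rfl | rfl
    · exact key (i := 2) (j := 0) (s := 5) (a := 0) (t := 5) (b := 0) (u := 5) (c := 0) (v := 5) (e := 0)
        (by norm_num) (by norm_num) (by norm_num) (by norm_num) (by norm_num)
    · exact key (i := 3) (j := 1) (s := 5) (a := 0) (t := 5) (b := 0) (u := 5) (c := 0) (v := 5) (e := 0)
        (by norm_num) (by norm_num) (by norm_num) (by norm_num) (by norm_num)
    · exact key (i := 2) (j := 0) (s := 31) (a := 1) (t := 5) (b := 0) (u := 5) (c := 0) (v := 5) (e := 0)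
        (by norm_num) (by norm_num) (by norm_num) (by norm_num) (by norm_num)
    · exact key (i := 4) (j := 1) (s := 13) (a := 1) (t := 5) (b := 0) (u := 5) (c := 0) (v := 5) (e := 0)
        (by norm_num) (by norm_num) (by norm_num) (by norm_num) (by norm_num)
    · exact key (i := 2) (j := 0) (s := 11) (a := 1) (t := 71) (b := 1) (u := 5) (c := 0) (v := 5) (e := 0)
        (by norm_num) (by norm_num) (by norm_num) (by norm_num) (by norm_num)
    · exact key (i := 3) (j := 2) (s := 7) (a := 1) (t := 31) (b := 1) (u := 5) (c := 0) (v := 5) (e := 0)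
        (by norm_num) (by norm_num) (by norm_num) (by norm_num) (by norm_num)
    · exact key (i := 2) (j := 0) (s := 19531) (a := 1) (t := 5) (b := 0) (u := 5) (c := 0) (v := 5) (e := 0)
        (by norm_num) (by norm_num) (by norm_num) (by norm_num) (by norm_num)
    · exact key (i := 5) (j := 1) (s := 13) (a := 1) (t := 313) (b := 1) (u := 5) (c := 0) (v := 5) (e := 0)
        (by norm_num) (by norm_num) (by norm_num) (by norm_num) (by norm_num)
    · exact key (i := 2) (j := 0) (s := 19) (a := 1) (t := 31) (b := 1) (u := 829) (c := 1) (v := 5) (e := 0)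
        (by norm_num) (by norm_num) (by norm_num) (by norm_num) (by norm_num)
    · exact key (i := 3) (j := 1) (s := 11) (a := 1) (t := 71) (b := 1) (u := 521) (c := 1) (v := 5) (e := 0)
        (by norm_num) (by norm_num) (by norm_num) (by norm_num) (by norm_num)
    · exact key (i := 2) (j := 0) (s := 12207031) (a := 1) (t := 5) (b := 0) (u := 5) (c := 0) (v := 5) (e := 0)
        (by norm_num) (by norm_num) (by norm_num) (by norm_num) (by norm_num)
    · exact key (i := 4) (j := 2) (s := 7) (a := 1) (t := 13) (b := 1) (u := 31) (c := 1) (v := 601) (e := 1)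
        (by norm_num) (by norm_num) (by norm_num) (by norm_num) (by norm_num)
    · exact key (i := 2) (j := 0) (s := 305175781) (a := 1) (t := 5) (b := 0) (u := 5) (c := 0) (v := 5) (e := 0)
        (by norm_num) (by norm_num) (by norm_num) (by norm_num) (by norm_num)
  · have hd' : d = 1 ∨ d = 2 ∨ d = 3 ∨ d = 4 ∨ d = 5 ∨ d = 6 ∨ d = 7 ∨ d = 8 ∨ d = 9 := by omega
    rcases hd' with rfl | rfl | rfl | rfl | rfl | rfl | rfl | rfl | rfl
    · exact key (i := 1) (j := 1) (s := 5) (a := 0) (t := 5) (b := 0) (u := 5) (c := 0) (v := 5) (e := 0)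
        (by norm_num) (by norm_num) (by norm_num) (by norm_num) (by norm_num)
    · exact key (i := 4) (j := 1) (s := 5) (a := 0) (t := 5) (b := 0) (u := 5) (c := 0) (v := 5) (e := 0)
        (by norm_num) (by norm_num) (by norm_num) (by norm_num) (by norm_num)
    · exact key (i := 1) (j := 2) (s := 19) (a := 1) (t := 5) (b := 0) (u := 5) (c := 0) (v := 5) (e := 0)
        (by norm_num) (by norm_num) (by norm_num) (by norm_num) (by norm_num)
    · exact key (i := 5) (j := 1) (s := 5) (a := 2) (t := 5) (b := 0) (u := 5) (c := 0) (v := 5) (e := 0)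
        (by norm_num) (by norm_num) (by norm_num) (by norm_num) (by norm_num)
    · exact key (i := 1) (j := 1) (s := 2801) (a := 1) (t := 5) (b := 0) (u := 5) (c := 0) (v := 5) (e := 0)
        (by norm_num) (by norm_num) (by norm_num) (by norm_num) (by norm_num)
    · exact key (i := 4) (j := 2) (s := 19) (a := 1) (t := 43) (b := 1) (u := 5) (c := 0) (v := 5) (e := 0)
        (by norm_num) (by norm_num) (by norm_num) (by norm_num) (by norm_num)
    · exact key (i := 1) (j := 1) (s := 29) (a := 1) (t := 4733) (b := 1) (u := 5) (c := 0) (v := 5) (e := 0)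
        (by norm_num) (by norm_num) (by norm_num) (by norm_num) (by norm_num)
    · exact key (i := 6) (j := 1) (s := 5) (a := 2) (t := 1201) (b := 1) (u := 5) (c := 0) (v := 5) (e := 0)
        (by norm_num) (by norm_num) (by norm_num) (by norm_num) (by norm_num)
    · exact key (i := 1) (j := 3) (s := 19) (a := 1) (t := 37) (b := 1) (u := 1063) (c := 1) (v := 5) (e := 0)
        (by norm_num) (by norm_num) (by norm_num) (by norm_num) (by norm_num)

end TableOne

/-! ## §2 The per-prime bound `(ℓ − 1)·d ≥ 6m + 1` when `m − 1 ∈ [5, 8]` distinct primes `≥ 5` divide `ℓᵈ − 1` -/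

section PerPrime

/-- `Bᵈ < T ≤ ℓᵈ` forces `ℓ ≥ B + 1`. [folklore] -/
private theorem succ_le_of_pow_lt_of_le_pow {ℓ d T B : ℕ} (h : T ≤ ℓ ^ d) (hB : B ^ d < T) : B + 1 ≤ ℓ := by
  by_contra hlt
  have hle : ℓ ≤ B := by omega
  exact absurd (lt_of_lt_of_le hB (h.trans (Nat.pow_le_pow_left hle d))) (lt_irrefl _)

/-- The size bound for `ℓ ≥ 11`: if `5ᵏ + 1 ≤ ℓᵈ` with `5 ≤ k ≤ 8` and `d ≥ 1`, then `6(k + 1) + 1 ≤ (ℓ − 1)·d`. [folklore] -/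
private theorem criterion_of_pow_succ_le_pow {ℓ d k : ℕ} (hℓ : 11 ≤ ℓ) (hd : 0 < d) (h5 : 5 ≤ k) (h8 : k ≤ 8)
    (h : 5 ^ k + 1 ≤ ℓ ^ d) : 6 * (k + 1) + 1 ≤ (ℓ - 1) * d := by
  have hk : k = 5 ∨ k = 6 ∨ k = 7 ∨ k = 8 := by omega
  have hd' : d = 1 ∨ d = 2 ∨ d = 3 ∨ d = 4 ∨ d = 5 ∨ 6 ≤ d := by omega
  rcases hd' with rfl | rfl | rfl | rfl | rfl | hd6
  · -- `d = 1`: `ℓ ≥ 5ᵏ + 1`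
    rcases hk with rfl | rfl | rfl | rfl
    · have := succ_le_of_pow_lt_of_le_pow h (show 3125 ^ 1 < 5 ^ 5 + 1 by norm_num); omega
    · have := succ_le_of_pow_lt_of_le_pow h (show 15625 ^ 1 < 5 ^ 6 + 1 by norm_num); omega
    · have := succ_le_of_pow_lt_of_le_pow h (show 78125 ^ 1 < 5 ^ 7 + 1 by norm_num); omega
    · have := succ_le_of_pow_lt_of_le_pow h (show 390625 ^ 1 < 5 ^ 8 + 1 by norm_num); omega
  · -- `d = 2`
    rcases hk with rfl | rfl | rfl | rfl
    · have := succ_le_of_pow_lt_of_le_pow h (show 19 ^ 2 < 5 ^ 5 + 1 by norm_num); omega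
    · have := succ_le_of_pow_lt_of_le_pow h (show 22 ^ 2 < 5 ^ 6 + 1 by norm_num); omega
    · have := succ_le_of_pow_lt_of_le_pow h (show 25 ^ 2 < 5 ^ 7 + 1 by norm_num); omega
    · have := succ_le_of_pow_lt_of_le_pow h (show 28 ^ 2 < 5 ^ 8 + 1 by norm_num); omega
  · -- `d = 3`
    rcases hk with rfl | rfl | rfl | rfl
    · have := succ_le_of_pow_lt_of_le_pow h (show 13 ^ 3 < 5 ^ 5 + 1 by norm_num); omega
    · have := succ_le_of_pow_lt_of_le_pow h (show 15 ^ 3 < 5 ^ 6 + 1 by norm_num); omega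
    · have := succ_le_of_pow_lt_of_le_pow h (show 17 ^ 3 < 5 ^ 7 + 1 by norm_num); omega
    · have := succ_le_of_pow_lt_of_le_pow h (show 19 ^ 3 < 5 ^ 8 + 1 by norm_num); omega
  · -- `d = 4`
    rcases hk with rfl | rfl | rfl | rfl
    · omega
    · have := succ_le_of_pow_lt_of_le_pow h (show 11 ^ 4 < 5 ^ 6 + 1 by norm_num); omega
    · have := succ_le_of_pow_lt_of_le_pow h (show 13 ^ 4 < 5 ^ 7 + 1 by norm_num); omega
    · have := succ_le_of_pow_lt_of_le_pow h (show 14 ^ 4 < 5 ^ 8 + 1 by norm_num); omega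
  · -- `d = 5`
    rcases hk with rfl | rfl | rfl | rfl
    · omega
    · omega
    · omega
    · have := succ_le_of_pow_lt_of_le_pow h (show 11 ^ 5 < 5 ^ 8 + 1 by norm_num); omega
  · -- `d ≥ 6`
    calc 6 * (k + 1) + 1 ≤ 10 * 6 := by omega
      _ ≤ (ℓ - 1) * d := Nat.mul_le_mul (by omega) hd6

/-- **`(ℓ − 1)·d ≥ 6m + 1` for `6 ≤ m ≤ 9`**: if `ℓ` is a prime `≥ 5`, `d ≥ 1`, and `Q` is a set of `m − 1 ∈ [5, 8]` primes `≥ 5` each dividing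
`ℓᵈ − 1`, then `6m + 1 ≤ (ℓ − 1)·d` — the per-prime input of K–R's Case 4 ("`5 ≤ m ≤ 9`.  From Table 1, if `pᵢ = 5, 7, 11`, then `ordᵢ ≥ 10, 10, 6`,
respectively, and if `13 ≤ pᵢ ≤ 29`, then `ordᵢ ≥ 5`"), here in the uniform shape consumed by the sibling criterion
`twelve_mul_card_bad_lt_totient_of_forall_le`: `ℓ = 5`: `d ≥ 14` by Table 1 extended (`#Q ≥ 5 > 4`); `ℓ = 7`: `d ≥ 10` likewise; `ℓ ≥ 11`:
`5^{#Q} ≤ ∏ Q ≤ ℓᵈ − 1` and a case analysis in `d ≤ 5`.  (K–R instead bound the whole sum `Σᵢ 1/((pᵢ − 1)·ordᵢ) < 1/6` non-uniformly; the uniform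
per-prime bound proved here is slightly stronger termwise for `ℓ = 5` and needs the four extra rows `d = 10, …, 13` of Table 1.)
[cite: KoblitzRohrlich1978, §2 Table 1 (p. 1190) and Proposition, Case 4 (pp. 1191–1192)] -/
theorem criterion_le_sub_one_mul_of_card_mem_Icc {ℓ d : ℕ} (hℓ : ℓ.Prime) (hℓ5 : 5 ≤ ℓ) (hd : 0 < d) {Q : Finset ℕ}
    (hQ : ∀ q ∈ Q, q.Prime ∧ 5 ≤ q ∧ q ∣ ℓ ^ d - 1) (h5 : 5 ≤ Q.card) (h8 : Q.card ≤ 8) :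
    6 * (Q.card + 1) + 1 ≤ (ℓ - 1) * d := by
  have hpos : 0 < ℓ ^ d - 1 := by
    have : ℓ ^ 1 ≤ ℓ ^ d := Nat.pow_le_pow_right hℓ.pos hd
    rw [pow_one] at this
    omega
  by_cases h11 : 11 ≤ ℓ
  · -- size: `5^{#Q} ≤ ∏ Q ∣ ℓᵈ − 1`
    have hprod : ∏ q ∈ Q, q ∣ ℓ ^ d - 1 :=
      Finset.prod_primes_dvd _ (fun q hq => Nat.prime_iff.1 (hQ q hq).1) fun q hq => (hQ q hq).2.2
    have hle : ∏ q ∈ Q, q ≤ ℓ ^ d - 1 := Nat.le_of_dvd hpos hprod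
    have hpow : 5 ^ Q.card ≤ ∏ q ∈ Q, q := Finset.pow_card_le_prod Q (fun q => q) 5 fun q hq => (hQ q hq).2.1
    have h1 : 1 ≤ ℓ ^ d := Nat.one_le_pow _ _ hℓ.pos
    exact criterion_of_pow_succ_le_pow h11 hd h5 h8 (by omega)
  · have hℓ57 : ℓ = 5 ∨ ℓ = 7 := by
      interval_cases ℓ
      · exact Or.inl rfl
      · exact absurd hℓ (by decide)
      · exact Or.inr rfl
      · exact absurd hℓ (by decide)
      · exact absurd hℓ (by decide)
      · exact absurd hℓ (by decide)
    rcases hℓ57 with rfl | rfl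
    · have hd14 : 14 ≤ d := by
        by_contra hlt
        have := card_le_four_of_forall_dvd_pow_sub_one (Or.inl ⟨rfl, by omega⟩) hd hQ
        omega
      omega
    · have hd10 : 10 ≤ d := by
        by_contra hlt
        have := card_le_four_of_forall_dvd_pow_sub_one (Or.inr ⟨rfl, by omega⟩) hd hQ
        omega
      omega

end PerPrime

/-! ## §3 The Proposition at levels with six to nine prime factors `≥ 5` -/

section CaseFour

variable {N : ℕ}

/-- The criterion's hypothesis at levels with `6 ≤ ω(N) ≤ 9` prime factors `≥ 5`. [cite: KoblitzRohrlich1978, §2 Proposition, Case 4 (pp. 1191–1192)] -/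
private theorem criterion_six_to_nine (h6 : 6 ≤ N.primeFactors.card) (h9 : N.primeFactors.card ≤ 9)
    (h5 : ∀ ℓ ∈ N.primeFactors, 5 ≤ ℓ) :
    ∀ ℓ ∈ N.primeFactors, ∀ d : ℕ, 0 < d → ordCompl[ℓ] N ∣ ℓ ^ d - 1 → 6 * N.primeFactors.card + 1 ≤ (ℓ - 1) * d := by
  classical
  intro ℓ hℓ d hd hdvd
  have hℓp : ℓ.Prime := Nat.prime_of_mem_primeFactors hℓ
  have mem : ∀ q ∈ N.primeFactors.erase ℓ, q.Prime ∧ 5 ≤ q ∧ q ∣ ℓ ^ d - 1 := by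
    intro q hq
    obtain ⟨hqℓ, hqN⟩ := Finset.mem_erase.1 hq
    have hqp : q.Prime := Nat.prime_of_mem_primeFactors hqN
    refine ⟨hqp, h5 q hqN, dvd_trans (Nat.dvd_ordCompl_of_dvd_not_dvd (Nat.dvd_of_mem_primeFactors hqN) ?_) hdvd⟩
    intro h
    exact hqℓ ((Nat.prime_dvd_prime_iff_eq hℓp hqp).1 h).symm
  have hc : (N.primeFactors.erase ℓ).card + 1 = N.primeFactors.card := Finset.card_erase_add_one hℓ
  rw [← hc]
  exact criterion_le_sub_one_mul_of_card_mem_Icc hℓp (h5 ℓ hℓ) hd mem (by omega) (by omega)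

/-- **THE PROPOSITION AT LEVELS WITH SIX TO NINE PRIME FACTORS** ("Case 4. `5 ≤ m ≤ 9`", the part `m ≥ 6`): if `N` has between six and nine
prime factors, all `≥ 5`, then `12·#{χ mod N odd : B_{1,χ} = 0} < φ(N)`. [cite: KoblitzRohrlich1978, §2 Proposition (p. 1190) and Case 4 (pp. 1191–1192)] -/
theorem twelve_mul_card_bad_lt_totient_six_to_nine_primes [NeZero N] (h6 : 6 ≤ N.primeFactors.card)
    (h9 : N.primeFactors.card ≤ 9) (h5 : ∀ ℓ ∈ N.primeFactors, 5 ≤ ℓ) :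
    12 * Nat.card {χ : DirichletCharacter ℂ N // χ.Odd ∧ bernoulliOneChar χ = 0} < N.totient :=
  twelve_mul_card_bad_lt_totient_of_forall_le (criterion_six_to_nine h6 h9 h5)

/-- The sibling's hypothesis at levels with six to nine prime factors `≥ 5`. [cite: KoblitzRohrlich1978, §2 Proposition (p. 1190) and Case 4 (pp. 1191–1192)] -/
theorem exists_goodFinset_six_to_nine_primes [NeZero N] (h6 : 6 ≤ N.primeFactors.card) (h9 : N.primeFactors.card ≤ 9)
    (h5 : ∀ ℓ ∈ N.primeFactors, 5 ≤ ℓ) :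
    ∃ S₀ : Finset (DirichletCharacter ℂ N),
      (∀ ψ : DirichletCharacter ℂ N, ψ.Odd → bernoulliOneChar ψ = 0 → ψ ∈ S₀) ∧ 12 * S₀.card < N.totient :=
  exists_goodFinset_of_forall_le (criterion_six_to_nine h6 h9 h5)

end CaseFour

/-! ## §4 Theorems 1 (i)–(ii) and 2, relatively prime case, UNCONDITIONALLY at levels with six to nine prime factors `≥ 5` -/

section SixToNinePrimeLevel

open CategoryTheory
open Literature.AlgebraicGeometry.Motives (AbelianVariety)
open Literature.AlgebraicGeometry.HodgeTheory
open Literature.AlgebraicGeometry.Pohlmann1968 Literature.AlgebraicGeometry.Pohlmann1968.Cyclotomic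
open CyclotomicCMTypeResidueSets (IsCMResidueSet)

variable {N : ℕ} [NeZero N]

/-- A level with six to nine prime factors, all `≥ 5`, is `> 1`, odd, and carries a good finset. [folklore] -/
private theorem level_hyps₆₉ (h6 : 6 ≤ N.primeFactors.card) (h9 : N.primeFactors.card ≤ 9) (h5 : ∀ ℓ ∈ N.primeFactors, 5 ≤ ℓ) :
    1 < N ∧ Odd N ∧ ∃ S₀ : Finset (DirichletCharacter ℂ N),
      (∀ ψ : DirichletCharacter ℂ N, ψ.Odd → bernoulliOneChar ψ = 0 → ψ ∈ S₀) ∧ 12 * S₀.card < N.totient := by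
  have hN0 : N ≠ 0 := NeZero.ne N
  have hN1 : 1 < N := by
    rcases Nat.lt_or_ge 1 N with h | h
    · exact h
    · exfalso
      have : N = 1 := by omega
      rw [this, Nat.primeFactors_one, Finset.card_empty] at h6
      omega
  have hodd : Odd N := by
    rw [← Nat.not_even_iff_odd]
    intro he
    have h2 : 2 ∈ N.primeFactors := Nat.mem_primeFactors.2 ⟨Nat.prime_two, even_iff_two_dvd.1 he, hN0⟩
    exact absurd (h5 2 h2) (by norm_num)
  exact ⟨hN1, hodd, exists_goodFinset_six_to_nine_primes h6 h9 h5⟩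

/-- **THEOREM 1 (i), unconditionally, at levels with six to nine prime factors (all `≥ 5`)**: for unit triples with vanishing sums and a unit `h`,
`H_{r₂,s₂,t₂} = h⁻¹H_{r₁,s₁,t₁}` iff `{r₂,s₂,t₂} = {hr₁,hs₁,ht₁}`. [cite: KoblitzRohrlich1978, Theorem 1 (i) (p. 1185) and §2 Proposition (pp. 1190–1192)] -/
theorem forall_mem_fermatCMType_iff_iff_multiset_eq_sixToNinePrimes (h6 : 6 ≤ N.primeFactors.card) (h9 : N.primeFactors.card ≤ 9)
    (h5 : ∀ ℓ ∈ N.primeFactors, 5 ≤ ℓ) {r₁ s₁ t₁ r₂ s₂ t₂ h : ZMod N}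
    (hr₁ : IsUnit r₁) (hs₁ : IsUnit s₁) (ht₁ : IsUnit t₁) (h₁ : r₁ + s₁ + t₁ = 0)
    (hr₂ : IsUnit r₂) (hs₂ : IsUnit s₂) (ht₂ : IsUnit t₂) (h₂ : r₂ + s₂ + t₂ = 0) (hh : IsUnit h) :
    (∀ x, x ∈ fermatCMType N r₂ s₂ t₂ ↔ h * x ∈ fermatCMType N r₁ s₁ t₁) ↔
      ({r₂, s₂, t₂} : Multiset (ZMod N)) = {h * r₁, h * s₁, h * t₁} := by
  obtain ⟨hN1, hN2, S₀, hS₀, hcard⟩ := level_hyps₆₉ h6 h9 h5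
  exact forall_mem_fermatCMType_iff_iff_multiset_eq_of_card hN1 hN2 S₀ hS₀ hcard hr₁ hs₁ ht₁ h₁ hr₂ hs₂ ht₂ h₂ hh

/-- **(∗)** at such levels: `H_{r₂,s₂,t₂} = H_{r₁,s₁,t₁}` iff `{r₂,s₂,t₂} = {r₁,s₁,t₁}`. [cite: KoblitzRohrlich1978, §2 (∗) (p. 1187) and Proposition (pp. 1190–1192)] -/
theorem fermatCMType_eq_iff_multiset_eq_sixToNinePrimes (h6 : 6 ≤ N.primeFactors.card) (h9 : N.primeFactors.card ≤ 9)
    (h5 : ∀ ℓ ∈ N.primeFactors, 5 ≤ ℓ) {r₁ s₁ t₁ r₂ s₂ t₂ : ZMod N}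
    (hr₁ : IsUnit r₁) (hs₁ : IsUnit s₁) (ht₁ : IsUnit t₁) (h₁ : r₁ + s₁ + t₁ = 0)
    (hr₂ : IsUnit r₂) (hs₂ : IsUnit s₂) (ht₂ : IsUnit t₂) (h₂ : r₂ + s₂ + t₂ = 0) :
    fermatCMType N r₂ s₂ t₂ = fermatCMType N r₁ s₁ t₁ ↔ ({r₂, s₂, t₂} : Multiset (ZMod N)) = {r₁, s₁, t₁} := by
  obtain ⟨hN1, hN2, S₀, hS₀, hcard⟩ := level_hyps₆₉ h6 h9 h5
  exact fermatCMType_eq_iff_multiset_eq_of_card hN1 hN2 S₀ hS₀ hcard hr₁ hs₁ ht₁ h₁ hr₂ hs₂ ht₂ h₂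

/-- **THEOREM 2's stabiliser** at such levels. [cite: KoblitzRohrlich1978, Theorem 2 (pp. 1185–1186) and Proposition (pp. 1190–1192)] -/
theorem forall_mem_fermatCMType_one_iff_mul_mem_iff_sixToNinePrimes (h6 : 6 ≤ N.primeFactors.card) (h9 : N.primeFactors.card ≤ 9)
    (h5 : ∀ ℓ ∈ N.primeFactors, 5 ≤ ℓ) {a₀ w : ZMod N} (ha₀ : IsUnit a₀) (ha₁ : IsUnit (1 + a₀)) (hw : IsUnit w) :
    (∀ x, x ∈ fermatCMType N 1 a₀ (-1 - a₀) ↔ w * x ∈ fermatCMType N 1 a₀ (-1 - a₀)) ↔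
      w = 1 ∨ (1 + a₀ + a₀ ^ 2 = 0 ∧ (w = a₀ ∨ w = a₀ ^ 2)) := by
  obtain ⟨hN1, hN2, S₀, hS₀, hcard⟩ := level_hyps₆₉ h6 h9 h5
  exact forall_mem_fermatCMType_one_iff_mul_mem_iff_of_card hN1 hN2 S₀ hS₀ hcard ha₀ ha₁ hw

variable {L : Type} [Field L] [NumberField L] [IsCyclotomicExtension {N} ℚ L]
  {A A' : AbelianVariety ℂ} {ι : 𝓞 L →+* End A} {θ : L →+* Module.End ℂ (complexBetti A.X 1)}
  {ι' : 𝓞 L →+* End A'} {θ' : L →+* Module.End ℂ (complexBetti A'.X 1)}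

/-- **THEOREM 2 on CM types** at such levels: `Φ_{(1,a₀,−1−a₀)}` primitive iff NOT (`1 + a₀ + a₀² = 0` and `a₀ ≠ 1`).
[cite: KoblitzRohrlich1978, Theorem 2 (pp. 1185–1186) and Proposition (pp. 1190–1192)] [cite: Shimura1998, §8.2 Prop. 26] -/
theorem isPrimitive_fermat_one_iff_sixToNinePrimes (h6 : 6 ≤ N.primeFactors.card) (h9 : N.primeFactors.card ≤ 9)
    (h5 : ∀ ℓ ∈ N.primeFactors, 5 ≤ ℓ) {a₀ : ZMod N} (ha₀ : IsUnit a₀) (ha₁ : IsUnit (1 + a₀))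
    {hS : ∀ x : ZMod N, x.val.Coprime N → (x ∈ fermatCMType N 1 a₀ (-1 - a₀) ↔ -x ∉ fermatCMType N 1 a₀ (-1 - a₀))}
    (φ₀ : L →+* ℂ) :
    IsPrimitive (ℂ ≃+* ℂ) (cmTypeOfResidues (L := L) (fermatCMType N 1 a₀ (-1 - a₀)) hS).1 φ₀ ↔
      ¬(1 + a₀ + a₀ ^ 2 = 0 ∧ a₀ ≠ 1) := by
  obtain ⟨hN1, hN2, S₀, hS₀, hcard⟩ := level_hyps₆₉ h6 h9 h5
  exact isPrimitive_fermat_one_iff_of_card hN1 hN2 S₀ hS₀ hcard ha₀ ha₁ φ₀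

/-- **THEOREM 2 on abelian varieties** at such levels: simple iff NOT (`1 + a₀ + a₀² = 0` and `a₀ ≠ 1`).
[cite: KoblitzRohrlich1978, Theorem 2 (pp. 1185–1186) and Proposition (pp. 1190–1192)] [cite: Shimura1998, §8.2 Prop. 26] -/
theorem isSimple_of_fermat_one_iff_sixToNinePrimes (h6 : 6 ≤ N.primeFactors.card) (h9 : N.primeFactors.card ≤ 9)
    (h5 : ∀ ℓ ∈ N.primeFactors, 5 ≤ ℓ) {a₀ : ZMod N} (ha₀ : IsUnit a₀) (ha₁ : IsUnit (1 + a₀))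
    {hS : ∀ x : ZMod N, x.val.Coprime N → (x ∈ fermatCMType N 1 a₀ (-1 - a₀) ↔ -x ∉ fermatCMType N 1 a₀ (-1 - a₀))}
    (hA : IsCMTypeRealisation (cmTypeOfResidues (L := L) (fermatCMType N 1 a₀ (-1 - a₀)) hS) A ι θ) :
    A.IsSimple ↔ ¬(1 + a₀ + a₀ ^ 2 = 0 ∧ a₀ ≠ 1) := by
  obtain ⟨hN1, hN2, S₀, hS₀, hcard⟩ := level_hyps₆₉ h6 h9 h5
  exact isSimple_of_fermat_one_iff_of_card hN1 hN2 S₀ hS₀ hcard ha₀ ha₁ hA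

/-- **THEOREM 1 (ii)** at such levels: isogeny iff `{r₂,s₂,t₂} = u·{r₁,s₁,t₁}` for a unit `u`.
[cite: KoblitzRohrlich1978, Theorem 1 (ii) (p. 1185) and Proposition (pp. 1190–1192)] [cite: Shimura1998, §8.4 Example (1) and §6.1 Corollary] -/
theorem isIsogenous_fermatCMType_iff_exists_multiset_eq_sixToNinePrimes [IsCMField L] (h6 : 6 ≤ N.primeFactors.card)
    (h9 : N.primeFactors.card ≤ 9) (h5 : ∀ ℓ ∈ N.primeFactors, 5 ≤ ℓ) {r₁ s₁ t₁ r₂ s₂ t₂ : ZMod N}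
    (hr₁ : IsUnit r₁) (hs₁ : IsUnit s₁) (ht₁ : IsUnit t₁) (h₁ : r₁ + s₁ + t₁ = 0)
    (hr₂ : IsUnit r₂) (hs₂ : IsUnit s₂) (ht₂ : IsUnit t₂) (h₂ : r₂ + s₂ + t₂ = 0)
    (hS : IsCMResidueSet N (fermatCMType N r₁ s₁ t₁)) (hS' : IsCMResidueSet N (fermatCMType N r₂ s₂ t₂))
    (hA : IsCMTypeRealisation (cmTypeOfResidues (L := L) (fermatCMType N r₁ s₁ t₁) hS.cm) A ι θ)
    (hA' : IsCMTypeRealisation (cmTypeOfResidues (L := L) (fermatCMType N r₂ s₂ t₂) hS'.cm) A' ι' θ') :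
    AbelianVariety.IsIsogenous A A' ↔
      ∃ u : ZMod N, IsUnit u ∧ ({r₂, s₂, t₂} : Multiset (ZMod N)) = {u * r₁, u * s₁, u * t₁} := by
  obtain ⟨hN1, hN2, S₀, hS₀, hcard⟩ := level_hyps₆₉ h6 h9 h5
  exact isIsogenous_fermatCMType_iff_exists_multiset_eq_of_card hN1 hN2 S₀ hS₀ hcard hr₁ hs₁ ht₁ h₁ hr₂ hs₂ ht₂ h₂ hS hS'
    hA hA'

end SixToNinePrimeLevel

end CyclotomicFermatCMType

end Literature.AlgebraicGeometry.ComplexMultiplication
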